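import Summits.NavierStokesRegularity.FunctionalMining.StretchingLaminatePointwise
import HarnessLib

/-!
# K1-Q1 laminate step, part 7: the PRODUCTION statistic `∫ prodBC(G + ∇curl A)` of the laminate potential

Cell `pub-nsfunc` (host summit NavierStokesRegularity, topic `FunctionalMining`), prove seat gen 6, for the
`LaminateStep` node (dict BLUEPRINT §3). **Search for candidate a priori estimates; no regularity claim.**
Static smooth fields on `T³`.

`abs_statP_sub_le`: with the entrywise sup bounds `β_G, β_M, β_X`, the remainder sizes `ρ±` of the two confined
children and the six two-scale errors `τ` (hypotheses; produced by `Confinement.two_scale` in the assembly),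
`|∫ prodBC(G + ∇curl A) − (λ ∫prodBC(G₊ + X₊) + (1−λ) ∫prodBC(G₋ + X₋))| ≤ 162ρ(β_Z+ρ)² + Στ + ε·C₁ᴾ`
with `ρ = ρ₊ + ρ₋`, `β_Z = β_G + β_M + 2β_X` and the explicit `C₁ᴾ = statPConst β_G β_M β_X` (independent of
`ε` and of the fast scale). The combination of the elementary estimates is the purely real lemma `statP_combine`.
-/

noncomputable section

open MeasureTheory Set Filter Topology Function
open scoped ContDiff

namespace Summit.NavierStokesRegularity.FunctionalMining

open Literature.Analysis Literature.Analysis.FunctionSpaces Literature.Analysis.FunctionSpaces.Torus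
open Literature.Analysis.FluidPDE Literature.Analysis.FluidPDE.Torus
open LaminateWindow LaminateDirection WrapStretching Confinement Laminate

namespace LamData

/-! ## 1. The real bookkeeping -/

/-- **Combination of the production estimates** (pure real arithmetic). [ours; bookkeeping] -/
theorem statP_combine {IT IZ IY i1 i2 i3 j1 j2 j3 aP2 aP3 aM2 aM3 JP2 JP3 JM2 JM3 KP2 KM2 pYp pYm pGp pGm SP SM
    lam ε e1 e3 e4 τ1 τ2 τ3 σ1 σ2 σ3 bJ2 bJ3 dJ : ℝ}
    (hlam : 0 < lam) (hlam1 : lam < 1)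
    (H1 : |IT - IZ| ≤ e1) (H2 : IZ = IY + (i1 + i2 + i3) + (j1 + j2 + j3))
    (H3 : |IY - (lam * pYp + (1 - lam) * pYm)| ≤ e3)
    (H4p : |pYp - pGp| ≤ e4) (H4m : |pYm - pGm| ≤ e4)
    (H5 : |i1| ≤ τ1) (H6 : |i2 - aP2 * JP2| ≤ τ2) (H7 : |i3 - aP3 * JP3| ≤ τ3)
    (H5' : |j1| ≤ σ1) (H6' : |j2 - aM2 * JM2| ≤ σ2) (H7' : |j3 - aM3 * JM3| ≤ σ3)
    (hJP2 : |JP2| ≤ bJ2) (hJM2 : |JM2| ≤ bJ2) (hJP3 : |JP3| ≤ bJ3) (hJM3 : |JM3| ≤ bJ3)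
    (hK2 : |JP2 - KP2| ≤ dJ) (hK2' : |JM2 - KM2| ≤ dJ)
    (ha2 : |aP2 - lam| ≤ 4 * ε) (ha3 : |aP3 - lam| ≤ 4 * ε)
    (ha2' : |aM2 - (1 - lam)| ≤ 4 * ε) (ha3' : |aM3 - (1 - lam)| ≤ 4 * ε)
    (HSP : SP = pGp + (KP2 + JP3)) (HSM : SM = pGm + (KM2 + JM3)) :
    |IT - (lam * SP + (1 - lam) * SM)| ≤
      e1 + e3 + e4 + (τ1 + τ2 + τ3 + σ1 + σ2 + σ3) + 2 * (4 * ε * bJ2 + dJ + 4 * ε * bJ3) := by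
  have hε : 0 ≤ ε := by linarith [abs_nonneg (aP2 - lam)]
  have hbJ2 : 0 ≤ bJ2 := (abs_nonneg _).trans hJP2
  have hbJ3 : 0 ≤ bJ3 := (abs_nonneg _).trans hJP3
  have P1 : |(aP2 - lam) * JP2| ≤ 4 * ε * bJ2 := by
    rw [abs_mul]; exact mul_le_mul ha2 hJP2 (abs_nonneg _) (by positivity)
  have P2 : |(aP3 - lam) * JP3| ≤ 4 * ε * bJ3 := by
    rw [abs_mul]; exact mul_le_mul ha3 hJP3 (abs_nonneg _) (by positivity)
  have P3 : |(aM2 - (1 - lam)) * JM2| ≤ 4 * ε * bJ2 := by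
    rw [abs_mul]; exact mul_le_mul ha2' hJM2 (abs_nonneg _) (by positivity)
  have P4 : |(aM3 - (1 - lam)) * JM3| ≤ 4 * ε * bJ3 := by
    rw [abs_mul]; exact mul_le_mul ha3' hJM3 (abs_nonneg _) (by positivity)
  have P5 : |lam * (JP2 - KP2)| ≤ dJ := by
    rw [abs_mul, abs_of_pos hlam]; exact (mul_le_of_le_one_left (abs_nonneg _) hlam1.le).trans hK2
  have P6 : |(1 - lam) * (JM2 - KM2)| ≤ dJ := by
    rw [abs_mul, abs_of_pos (by linarith)]; exact (mul_le_of_le_one_left (abs_nonneg _) (by linarith)).trans hK2'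
  have P7 : |lam * (pYp - pGp)| ≤ lam * e4 := by
    rw [abs_mul, abs_of_pos hlam]; exact mul_le_mul_of_nonneg_left H4p hlam.le
  have P8 : |(1 - lam) * (pYm - pGm)| ≤ (1 - lam) * e4 := by
    rw [abs_mul, abs_of_pos (by linarith)]; exact mul_le_mul_of_nonneg_left H4m (by linarith)
  have e : IT - (lam * SP + (1 - lam) * SM) =
      (IT - IZ) + (IY - (lam * pYp + (1 - lam) * pYm)) + lam * (pYp - pGp) + (1 - lam) * (pYm - pGm) +
      i1 + ((i2 - aP2 * JP2) + (aP2 - lam) * JP2 + lam * (JP2 - KP2)) + ((i3 - aP3 * JP3) + (aP3 - lam) * JP3) +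
      j1 + ((j2 - aM2 * JM2) + (aM2 - (1 - lam)) * JM2 + (1 - lam) * (JM2 - KM2)) +
      ((j3 - aM3 * JM3) + (aM3 - (1 - lam)) * JM3) := by
    rw [H2, HSP, HSM]; ring
  rw [e, abs_le]
  obtain ⟨a1, b1⟩ := abs_le.1 H1
  obtain ⟨a3, b3⟩ := abs_le.1 H3
  obtain ⟨a5, b5⟩ := abs_le.1 H5
  obtain ⟨a6, b6⟩ := abs_le.1 H6
  obtain ⟨a7, b7⟩ := abs_le.1 H7
  obtain ⟨a8, b8⟩ := abs_le.1 H5'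
  obtain ⟨a9, b9⟩ := abs_le.1 H6'
  obtain ⟨a10, b10⟩ := abs_le.1 H7'
  obtain ⟨c1, d1⟩ := abs_le.1 P1
  obtain ⟨c2, d2⟩ := abs_le.1 P2
  obtain ⟨c3, d3⟩ := abs_le.1 P3
  obtain ⟨c4, d4⟩ := abs_le.1 P4
  obtain ⟨c5, d5⟩ := abs_le.1 P5
  obtain ⟨c6, d6⟩ := abs_le.1 P6
  obtain ⟨c7, d7⟩ := abs_le.1 P7
  obtain ⟨c8, d8⟩ := abs_le.1 P8
  constructor <;> linarith

/-- The `ε`-coefficient of the production error (depends on the sup bounds only). [ours; bookkeeping] -/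
def statPConst (βG βM βX : ℝ) : ℝ :=
  216 * (βG + βM) ^ 3 + 324 * βM * (βG + 2 * βM) ^ 2 + 1296 * (βG + βM) * βX ^ 2 + 648 * βM * βX ^ 2 + 432 * βX ^ 3

/-- The `ε`-terms of the production error are dominated by `ε · statPConst`. [ours; bookkeeping] -/
theorem statP_eps_terms_le {βG βM βX ε : ℝ} (hβG : 0 ≤ βG) (hβM : 0 ≤ βM) (hε : 0 ≤ ε) (hε4 : ε ≤ 1 / 4) :
    4 * ε * (54 * (βG + βM) ^ 3) + 162 * (2 * ε * βM) * ((βG + βM) + 2 * ε * βM) ^ 2 +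
      2 * (4 * ε * (162 * (βG + βM) * βX ^ 2) + 162 * (2 * ε * βM) * βX ^ 2 + 4 * ε * (54 * βX ^ 3)) ≤
      ε * statPConst βG βM βX := by
  have hsq : ((βG + βM) + 2 * ε * βM) ^ 2 ≤ (βG + 2 * βM) ^ 2 :=
    pow_le_pow_left₀ (by positivity) (by nlinarith) 2
  have h2 : 162 * (2 * ε * βM) * ((βG + βM) + 2 * ε * βM) ^ 2 ≤ 162 * (2 * ε * βM) * (βG + 2 * βM) ^ 2 :=
    mul_le_mul_of_nonneg_left hsq (by positivity)
  calc _ ≤ 4 * ε * (54 * (βG + βM) ^ 3) + 162 * (2 * ε * βM) * (βG + 2 * βM) ^ 2 +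
      2 * (4 * ε * (162 * (βG + βM) * βX ^ 2) + 162 * (2 * ε * βM) * βX ^ 2 + 4 * ε * (54 * βX ^ 3)) := by linarith
    _ = ε * statPConst βG βM βX := by unfold statPConst; ring

variable (D : LamData)

section StatP

variable {G : Fin 3 → Fin 3 → ℝ} {βG βM βX ρp ρm : ℝ} {m : ℕ}
variable (hβG : ∀ i j, |G i j| ≤ βG) (hβM : ∀ i j, |D.M i j| ≤ βM)
  (hβXp : ∀ y i j, |D.XP y i j| ≤ βX) (hβXm : ∀ y i j, |D.XM y i j| ≤ βX)
  (hRp : ∀ x i j, |gradAt (curlField (D.BP m)) x i j - D.EP x * D.XP (m • x) i j| ≤ ρp)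
  (hRm : ∀ x i j, |gradAt (curlField (D.BM m)) x i j - D.EM x * D.XM (m • x) i j| ≤ ρm)

/-! ## 2. Entry bounds of the bases -/

omit hβG hβM in
/-- Entry bounds of the plateau base `Y₊`. [ours; bookkeeping] -/
theorem abs_Yp_le (hβG : ∀ i j, |G i j| ≤ βG) (hβM : ∀ i j, |D.M i j| ≤ βM) (i j : Fin 3) :
    |D.Yp G i j| ≤ βG + βM := by
  have hμ := D.q.mu_bounds
  exact abs_add_smul_entry_le hβG hβM (by rw [abs_le]; constructor <;> linarith [D.q.mu_pos, D.q.lam_lt_one]) i j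

omit hβG hβM in
/-- Entry bounds of the plateau base `Y₋`. [ours; bookkeeping] -/
theorem abs_Ym_le (hβG : ∀ i j, |G i j| ≤ βG) (hβM : ∀ i j, |D.M i j| ≤ βM) (i j : Fin 3) :
    |D.Ym G i j| ≤ βG + βM := by
  have hμ := D.q.mu_bounds
  exact abs_add_smul_entry_le hβG hβM (by rw [abs_le]; constructor <;> linarith [D.q.mu_pos, D.q.lam_lt_one]) i j

omit hβG hβM in
/-- Entry bounds of the child state `G₊`. [ours; bookkeeping] -/
theorem abs_Gp_le (hβG : ∀ i j, |G i j| ≤ βG) (hβM : ∀ i j, |D.M i j| ≤ βM) (i j : Fin 3) :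
    |D.Gp G i j| ≤ βG + βM :=
  abs_add_smul_entry_le hβG hβM (by rw [abs_le]; constructor <;> linarith [D.q.lam_pos, D.q.lam_lt_one]) i j

omit hβG hβM in
/-- Entry bounds of the child state `G₋`. [ours; bookkeeping] -/
theorem abs_Gm_le (hβG : ∀ i j, |G i j| ≤ βG) (hβM : ∀ i j, |D.M i j| ≤ βM) (i j : Fin 3) :
    |D.Gm G i j| ≤ βG + βM :=
  abs_add_smul_entry_le hβG hβM (by rw [abs_le]; constructor <;> linarith [D.q.lam_pos, D.q.lam_lt_one]) i j

omit hβM in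
/-- `Y₊ − G₊ = (λ − μ)M` entrywise, of size `≤ 2εβ_M`. [ours; bookkeeping] -/
theorem abs_Yp_sub_Gp_le (hβM : ∀ i j, |D.M i j| ≤ βM) (i j : Fin 3) : |D.Yp G i j - 1 * D.Gp G i j| ≤ 2 * D.q.eps * βM := by
  simp only [Yp, Gp, Pi.add_apply, Pi.smul_apply, smul_eq_mul, one_mul]
  rw [show G i j + (1 - D.q.mu) * D.M i j - (G i j + (1 - D.q.lam) * D.M i j) = (D.q.lam - D.q.mu) * D.M i j by ring,
    abs_mul, abs_sub_comm]
  exact mul_le_mul D.q.abs_mu_sub_lam_le (hβM i j) (abs_nonneg _) (by linarith [D.q.heps])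

omit hβM in
/-- `Y₋ − G₋ = (λ − μ)M` entrywise, of size `≤ 2εβ_M`. [ours; bookkeeping] -/
theorem abs_Ym_sub_Gm_le (hβM : ∀ i j, |D.M i j| ≤ βM) (i j : Fin 3) : |D.Ym G i j - 1 * D.Gm G i j| ≤ 2 * D.q.eps * βM := by
  simp only [Ym, Gm, Pi.add_apply, Pi.smul_apply, smul_eq_mul, one_mul]
  rw [show G i j + (-D.q.mu) * D.M i j - (G i j + (-D.q.lam) * D.M i j) = (D.q.lam - D.q.mu) * D.M i j by ring,
    abs_mul, abs_sub_comm]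
  exact mul_le_mul D.q.abs_mu_sub_lam_le (hβM i j) (abs_nonneg _) (by linarith [D.q.heps])

/-! ## 3. The pieces -/

/-- `∫ prodBC(Y + X(y)) dy = prodBC Y + ∫ mix₂ Y X + ∫ prodBC X` when the entries of `X = ∇curl A` have mean zero
(the linear term integrates to `0`). [ours] -/
theorem integral_prodBC_add_gradAt {A : UnitAddTorus (Fin 3) → EuclideanSpace ℝ (Fin 3)} (hA : IsSmooth A)
    (Y : Fin 3 → Fin 3 → ℝ) :
    ∫ y, prodBC (Y + gradAt (curlField A) y) =
      prodBC Y + ((∫ y, mix₂ Y (gradAt (curlField A) y)) + ∫ y, prodBC (gradAt (curlField A) y)) := by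
  have hF := isSmooth_curlField hA
  have h1 : Integrable (fun y => mix₁ Y (gradAt (curlField A) y)) := (isSmooth_mix₁_gradAt hF Y).integrable
  have h2 : Integrable (fun y => mix₂ Y (gradAt (curlField A) y)) := (isSmooth_mix₂_gradAt hF Y).integrable
  have h3 : Integrable (fun y => prodBC (gradAt (curlField A) y)) := (isSmooth_prodBC_gradAt hF).integrable
  have h23 : Integrable (fun y => mix₂ Y (gradAt (curlField A) y) + prodBC (gradAt (curlField A) y)) := h2.add h3
  have h123 : Integrable (fun y => mix₁ Y (gradAt (curlField A) y) +
      (mix₂ Y (gradAt (curlField A) y) + prodBC (gradAt (curlField A) y))) := h1.add h23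
  have h0 : ∫ y, mix₁ Y (gradAt (curlField A) y) = 0 :=
    integral_mix₁_eq_zero Y (integrable_gradAt_curlField hA) (integral_gradAt_curlField_eq_zero hA)
  simp_rw [prodBC_add']
  rw [integral_add (integrable_const _) h123, integral_add h1 h23, integral_add h2 h3, h0, zero_add]
  simp

/-- Target expansion for the `+` child in the `LamData` vocabulary. [ours; bookkeeping] -/
theorem integral_prodBC_Gp (G : Fin 3 → Fin 3 → ℝ) :
    ∫ y, prodBC (D.Gp G + D.XP y) = prodBC (D.Gp G) + ((∫ y, mix₂ (D.Gp G) (D.XP y)) + ∫ y, prodBC (D.XP y)) :=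
  integral_prodBC_add_gradAt D.hAp _

/-- Target expansion for the `−` child in the `LamData` vocabulary. [ours; bookkeeping] -/
theorem integral_prodBC_Gm (G : Fin 3 → Fin 3 → ℝ) :
    ∫ y, prodBC (D.Gm G + D.XM y) = prodBC (D.Gm G) + ((∫ y, mix₂ (D.Gm G) (D.XM y)) + ∫ y, prodBC (D.XM y)) :=
  integral_prodBC_add_gradAt D.hAm _

/-- **The plateau expansion, integrated.** [ours] -/
theorem integral_prodBC_Z_eq (G : Fin 3 → Fin 3 → ℝ) (m : ℕ) :
    ∫ x, prodBC (D.Z G m x) = (∫ x, prodBC (G + D.slope x • D.M)) +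
      ((∫ x, D.EP x * mix₁ (D.Yp G) (D.XP (m • x))) + (∫ x, D.EP x ^ 2 * mix₂ (D.Yp G) (D.XP (m • x))) +
        ∫ x, D.EP x ^ 3 * prodBC (D.XP (m • x))) +
      ((∫ x, D.EM x * mix₁ (D.Ym G) (D.XM (m • x))) + (∫ x, D.EM x ^ 2 * mix₂ (D.Ym G) (D.XM (m • x))) +
        ∫ x, D.EM x ^ 3 * prodBC (D.XM (m • x))) := by
  have hFp := isSmooth_curlField D.hAp
  have hFm := isSmooth_curlField D.hAm
  have hcY : Continuous fun x => prodBC (G + D.slope x • D.M) := continuous_prodBC' (D.continuous_lam_apply G)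
  have hcP := (D.isSmooth_EP).continuous
  have hcM := (D.isSmooth_EM).continuous
  have hc1 : Continuous fun x => D.EP x * mix₁ (D.Yp G) (D.XP (m • x)) :=
    hcP.mul ((isSmooth_mix₁_gradAt hFp _).continuous.comp (continuous_nsmul m))
  have hc2 : Continuous fun x => D.EP x ^ 2 * mix₂ (D.Yp G) (D.XP (m • x)) :=
    (hcP.pow 2).mul ((isSmooth_mix₂_gradAt hFp _).continuous.comp (continuous_nsmul m))
  have hc3 : Continuous fun x => D.EP x ^ 3 * prodBC (D.XP (m • x)) :=
    (hcP.pow 3).mul ((isSmooth_prodBC_gradAt hFp).continuous.comp (continuous_nsmul m))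
  have hd1 : Continuous fun x => D.EM x * mix₁ (D.Ym G) (D.XM (m • x)) :=
    hcM.mul ((isSmooth_mix₁_gradAt hFm _).continuous.comp (continuous_nsmul m))
  have hd2 : Continuous fun x => D.EM x ^ 2 * mix₂ (D.Ym G) (D.XM (m • x)) :=
    (hcM.pow 2).mul ((isSmooth_mix₂_gradAt hFm _).continuous.comp (continuous_nsmul m))
  have hd3 : Continuous fun x => D.EM x ^ 3 * prodBC (D.XM (m • x)) :=
    (hcM.pow 3).mul ((isSmooth_prodBC_gradAt hFm).continuous.comp (continuous_nsmul m))
  have i12 : Integrable (fun x => D.EP x * mix₁ (D.Yp G) (D.XP (m • x)) + D.EP x ^ 2 * mix₂ (D.Yp G) (D.XP (m • x))) :=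
    (hc1.add hc2).integrable_unitAddTorus
  have i123 : Integrable (fun x => D.EP x * mix₁ (D.Yp G) (D.XP (m • x)) + D.EP x ^ 2 * mix₂ (D.Yp G) (D.XP (m • x)) +
      D.EP x ^ 3 * prodBC (D.XP (m • x))) := ((hc1.add hc2).add hc3).integrable_unitAddTorus
  have j12 : Integrable (fun x => D.EM x * mix₁ (D.Ym G) (D.XM (m • x)) + D.EM x ^ 2 * mix₂ (D.Ym G) (D.XM (m • x))) :=
    (hd1.add hd2).integrable_unitAddTorus
  have j123 : Integrable (fun x => D.EM x * mix₁ (D.Ym G) (D.XM (m • x)) + D.EM x ^ 2 * mix₂ (D.Ym G) (D.XM (m • x)) +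
      D.EM x ^ 3 * prodBC (D.XM (m • x))) := ((hd1.add hd2).add hd3).integrable_unitAddTorus
  have iY123 : Integrable (fun x => prodBC (G + D.slope x • D.M) +
      (D.EP x * mix₁ (D.Yp G) (D.XP (m • x)) + D.EP x ^ 2 * mix₂ (D.Yp G) (D.XP (m • x)) +
        D.EP x ^ 3 * prodBC (D.XP (m • x)))) := (hcY.add ((hc1.add hc2).add hc3)).integrable_unitAddTorus
  simp_rw [D.prodBC_Z_eq]
  rw [integral_add iY123 j123, integral_add hcY.integrable_unitAddTorus i123, integral_add i12 hc3.integrable_unitAddTorus,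
    integral_add hc1.integrable_unitAddTorus hc2.integrable_unitAddTorus, integral_add j12 hd3.integrable_unitAddTorus,
    integral_add hd1.integrable_unitAddTorus hd2.integrable_unitAddTorus]

include hβG hβM in
/-- **The laminate part is two-valued up to `4εK`**, `K = 54(β_G + β_M)³`. [ours] -/
theorem abs_integral_lam_prodBC_sub_le :
    |(∫ x, prodBC (G + D.slope x • D.M)) - (D.q.lam * prodBC (D.Yp G) + (1 - D.q.lam) * prodBC (D.Ym G))| ≤
      4 * D.q.eps * (54 * (βG + βM) ^ 3) := by
  have hK : ∀ s ∈ Icc (0 : ℝ) 1, |prodBC (G + (s - D.q.mu) • D.M)| ≤ 54 * (βG + βM) ^ 3 := fun s hs => by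
    have hμ := D.q.mu_bounds
    refine abs_prodBC_le' (abs_add_smul_entry_le hβG hβM ?_)
    rw [abs_le]; constructor <;> linarith [hs.1, hs.2, D.q.mu_pos, D.q.lam_lt_one]
  have hQc : Continuous fun s : ℝ => prodBC (G + (s - D.q.mu) • D.M) :=
    continuous_prodBC' fun i j => by
      simp only [Pi.add_apply, Pi.smul_apply, smul_eq_mul]; fun_prop
  have h := D.abs_integral_comp_slope_sub_le hQc hK
  have e1 : ∀ x, G + (D.slope x + D.q.mu - D.q.mu) • D.M = G + D.slope x • D.M := fun x => by rw [add_sub_cancel_right]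
  simp only [e1, zero_sub] at h
  rw [show (1 : ℝ) - D.q.mu = 1 - D.q.mu from rfl] at h
  exact h

include hβG hβM in
/-- `|prodBC Y₊ − prodBC G₊| ≤ 324εβ_M(β_G + β_M + 2εβ_M)²`. [ours] -/
theorem abs_prodBC_Yp_sub_le : |prodBC (D.Yp G) - prodBC (D.Gp G)| ≤ 162 * (2 * D.q.eps * βM) * ((βG + βM) + 2 * D.q.eps * βM) ^ 2 := by
  have h1abs : |(1 : ℝ)| ≤ 1 := by rw [abs_one]
  have h := abs_prodBC_sub_le h1abs (D.abs_Gp_le hβG hβM) (D.abs_Yp_sub_Gp_le hβM)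
  simpa only [one_pow, one_mul] using h

include hβG hβM in
/-- `|prodBC Y₋ − prodBC G₋| ≤ 324εβ_M(β_G + β_M + 2εβ_M)²`. [ours] -/
theorem abs_prodBC_Ym_sub_le : |prodBC (D.Ym G) - prodBC (D.Gm G)| ≤ 162 * (2 * D.q.eps * βM) * ((βG + βM) + 2 * D.q.eps * βM) ^ 2 := by
  have h1abs : |(1 : ℝ)| ≤ 1 := by rw [abs_one]
  have h := abs_prodBC_sub_le h1abs (D.abs_Gm_le hβG hβM) (D.abs_Ym_sub_Gm_le hβM)
  simpa only [one_pow, one_mul] using h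

/-- Size of an average: `|∫ f| ≤ c` if `|f| ≤ c` pointwise (probability space, continuous `f`). [folklore] -/
theorem abs_integral_le_of_pointwise {f : UnitAddTorus (Fin 3) → ℝ} (hf : Continuous f) {c : ℝ} (h : ∀ x, |f x| ≤ c) :
    |∫ x, f x| ≤ c := by
  have := abs_integral_sub_le_of_pointwise hf continuous_const (g := fun _ => (0 : ℝ)) (c := c) (fun x => by simpa using h x)
  simpa using this

include hβG hβM hβXp in
/-- `|∫ mix₂ Y₊ X₊| ≤ 162(β_G+β_M)β_X²`. [ours; bookkeeping] -/
theorem abs_JP2_le : |∫ y, mix₂ (D.Yp G) (D.XP y)| ≤ 162 * (βG + βM) * βX ^ 2 :=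
  abs_integral_le_of_pointwise (isSmooth_mix₂_gradAt (isSmooth_curlField D.hAp) _).continuous
    fun y => abs_mix₂_le (D.abs_Yp_le hβG hβM) (hβXp y)

include hβG hβM hβXm in
/-- `|∫ mix₂ Y₋ X₋| ≤ 162(β_G+β_M)β_X²`. [ours; bookkeeping] -/
theorem abs_JM2_le : |∫ y, mix₂ (D.Ym G) (D.XM y)| ≤ 162 * (βG + βM) * βX ^ 2 :=
  abs_integral_le_of_pointwise (isSmooth_mix₂_gradAt (isSmooth_curlField D.hAm) _).continuous
    fun y => abs_mix₂_le (D.abs_Ym_le hβG hβM) (hβXm y)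

include hβXp in
/-- `|∫ prodBC X₊| ≤ 54β_X³`. [ours; bookkeeping] -/
theorem abs_JP3_le : |∫ y, prodBC (D.XP y)| ≤ 54 * βX ^ 3 :=
  abs_integral_le_of_pointwise (isSmooth_prodBC_gradAt (isSmooth_curlField D.hAp)).continuous fun y => abs_prodBC_le' (hβXp y)

include hβXm in
/-- `|∫ prodBC X₋| ≤ 54β_X³`. [ours; bookkeeping] -/
theorem abs_JM3_le : |∫ y, prodBC (D.XM y)| ≤ 54 * βX ^ 3 :=
  abs_integral_le_of_pointwise (isSmooth_prodBC_gradAt (isSmooth_curlField D.hAm)).continuous fun y => abs_prodBC_le' (hβXm y)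

include hβM hβXp in
/-- `|∫ mix₂ Y₊ X₊ − ∫ mix₂ G₊ X₊| ≤ 324εβ_Mβ_X²`. [ours; bookkeeping] -/
theorem abs_JP2_sub_KP2_le : |(∫ y, mix₂ (D.Yp G) (D.XP y)) - ∫ y, mix₂ (D.Gp G) (D.XP y)| ≤ 162 * (2 * D.q.eps * βM) * βX ^ 2 := by
  have hF := isSmooth_curlField D.hAp
  refine abs_integral_sub_le_of_pointwise (isSmooth_mix₂_gradAt hF _).continuous (isSmooth_mix₂_gradAt hF _).continuous
    fun y => ?_
  rw [mix₂_sub_left]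
  refine abs_mix₂_le (fun i j => ?_) (hβXp y)
  have h := D.abs_Yp_sub_Gp_le (G := G) hβM i j
  rwa [one_mul] at h

include hβM hβXm in
/-- `|∫ mix₂ Y₋ X₋ − ∫ mix₂ G₋ X₋| ≤ 324εβ_Mβ_X²`. [ours; bookkeeping] -/
theorem abs_JM2_sub_KM2_le : |(∫ y, mix₂ (D.Ym G) (D.XM y)) - ∫ y, mix₂ (D.Gm G) (D.XM y)| ≤ 162 * (2 * D.q.eps * βM) * βX ^ 2 := by
  have hF := isSmooth_curlField D.hAm
  refine abs_integral_sub_le_of_pointwise (isSmooth_mix₂_gradAt hF _).continuous (isSmooth_mix₂_gradAt hF _).continuous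
    fun y => ?_
  rw [mix₂_sub_left]
  refine abs_mix₂_le (fun i j => ?_) (hβXm y)
  have h := D.abs_Ym_sub_Gm_le (G := G) hβM i j
  rwa [one_mul] at h

/-! ## 4. The production estimate -/

include hβG hβM hβXp hβXm hRp hRm in
/-- **THE PRODUCTION STATISTIC OF THE LAMINATE STEP.** Given the six two-scale errors at the scale `m`,
`|∫ prodBC(G + ∇curl A) − (λ·∫prodBC(G₊ + X₊) + (1−λ)·∫prodBC(G₋ + X₋))| ≤ 162ρ(β_Z+ρ)² + Στ + ε·C₁ᴾ`. [ours] -/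
theorem abs_statP_sub_le {τP1 τP2 τP3 τM1 τM2 τM3 : ℝ}
    (hτP1 : |(∫ x, D.EP x * mix₁ (D.Yp G) (D.XP (m • x))) - (∫ x, D.EP x) * ∫ y, mix₁ (D.Yp G) (D.XP y)| ≤ τP1)
    (hτP2 : |(∫ x, D.EP x ^ 2 * mix₂ (D.Yp G) (D.XP (m • x))) - (∫ x, D.EP x ^ 2) * ∫ y, mix₂ (D.Yp G) (D.XP y)| ≤ τP2)
    (hτP3 : |(∫ x, D.EP x ^ 3 * prodBC (D.XP (m • x))) - (∫ x, D.EP x ^ 3) * ∫ y, prodBC (D.XP y)| ≤ τP3)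
    (hτM1 : |(∫ x, D.EM x * mix₁ (D.Ym G) (D.XM (m • x))) - (∫ x, D.EM x) * ∫ y, mix₁ (D.Ym G) (D.XM y)| ≤ τM1)
    (hτM2 : |(∫ x, D.EM x ^ 2 * mix₂ (D.Ym G) (D.XM (m • x))) - (∫ x, D.EM x ^ 2) * ∫ y, mix₂ (D.Ym G) (D.XM y)| ≤ τM2)
    (hτM3 : |(∫ x, D.EM x ^ 3 * prodBC (D.XM (m • x))) - (∫ x, D.EM x ^ 3) * ∫ y, prodBC (D.XM y)| ≤ τM3) :
    |(∫ x, prodBC (D.T G m x)) -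
        (D.q.lam * (∫ y, prodBC (D.Gp G + D.XP y)) + (1 - D.q.lam) * ∫ y, prodBC (D.Gm G + D.XM y))| ≤
      162 * (ρp + ρm) * ((βG + βM + 2 * βX) + (ρp + ρm)) ^ 2 + (τP1 + τP2 + τP3 + τM1 + τM2 + τM3) +
        D.q.eps * statPConst βG βM βX := by
  have hε := D.q.heps
  have hε4 : D.q.eps ≤ 1 / 4 := by linarith [D.q.h4p, D.q.lam_lt_one]
  have hβG0 : 0 ≤ βG := (abs_nonneg _).trans (hβG 0 0)
  have hβM0 : 0 ≤ βM := (abs_nonneg _).trans (hβM 0 0)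
  -- the linear two-scale terms vanish on average
  have hJP1 : ∫ y, mix₁ (D.Yp G) (D.XP y) = 0 :=
    integral_mix₁_eq_zero _ (integrable_gradAt_curlField D.hAp) (integral_gradAt_curlField_eq_zero D.hAp)
  have hJM1 : ∫ y, mix₁ (D.Ym G) (D.XM y) = 0 :=
    integral_mix₁_eq_zero _ (integrable_gradAt_curlField D.hAm) (integral_gradAt_curlField_eq_zero D.hAm)
  rw [hJP1, mul_zero, sub_zero] at hτP1
  rw [hJM1, mul_zero, sub_zero] at hτM1
  have H1 : |(∫ x, prodBC (D.T G m x)) - ∫ x, prodBC (D.Z G m x)| ≤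
      162 * (ρp + ρm) * ((βG + βM + 2 * βX) + (ρp + ρm)) ^ 2 :=
    abs_integral_sub_le_of_pointwise (continuous_prodBC' (D.continuous_T_apply G m))
      (continuous_prodBC' (D.continuous_Z_apply G m)) fun x => D.abs_prodBC_T_sub_le hβG hβM hβXp hβXm hRp hRm x
  have h := statP_combine D.q.lam_pos D.q.lam_lt_one H1 (D.integral_prodBC_Z_eq G m)
    (D.abs_integral_lam_prodBC_sub_le hβG hβM) (D.abs_prodBC_Yp_sub_le hβG hβM) (D.abs_prodBC_Ym_sub_le hβG hβM)
    hτP1 hτP2 hτP3 hτM1 hτM2 hτM3 (D.abs_JP2_le hβG hβM hβXp) (D.abs_JM2_le hβG hβM hβXm) (D.abs_JP3_le hβXp)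
    (D.abs_JM3_le hβXm) (D.abs_JP2_sub_KP2_le hβM hβXp) (D.abs_JM2_sub_KM2_le hβM hβXm)
    (D.abs_integral_EP_pow_sub_le (by norm_num)) (D.abs_integral_EP_pow_sub_le (by norm_num))
    (D.abs_integral_EM_pow_sub_le (by norm_num)) (D.abs_integral_EM_pow_sub_le (by norm_num))
    (D.integral_prodBC_Gp G) (D.integral_prodBC_Gm G)
  have hdom := statP_eps_terms_le (βX := βX) hβG0 hβM0 hε.le hε4
  linarith

end StatP

end LamData

end Summit.NavierStokesRegularity.FunctionalMining

end
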